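import Summits.Parity.GeneralizedHardyLittlewood.Theorems.FordMaynardNoSieveConst0164NegWitness0164DefsTable

/-!
# Route `FordMaynardNoSieveConst0164`, crux `NegWitness0164` (stmt-Parity-19102), line `birth`,
# stub `stub_tweakNeg0164`: the orbit reorganisation of the table sums `Σ_t lpCoeff0164(t)·X(t)`

Helper file (def-free) for the numerical targets of `…NegWitness0164Numerics` (K. Ford, J. Maynard, *On the theory
of prime producing sieves*, arXiv:2407.14368, §8).  The table `lpCoeff0164 t = lpTable0164 (t sorted)` is summed over
ALL `24⁵` ordered cell indices `t : Fin 5 → Fin 24`; for a permutation-invariant nonnegative weight `X` the sum is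
reorganised over the sorted representatives: for any finite set `U` of monotone index tuples,

  `Σ_{u ∈ U} #orbit(u) · lpTable0164(u) · X(u) ≤ Σ_t lpCoeff0164(t) · X(t)`

(`sum_orbit_le_sum_lpCoeff`; equality when `U` contains the 97 sorted tuples of the table, not needed), where
`orbit(u) = {u ∘ σ : σ ∈ S₅}` (its cardinality `5!/∏ mᵢ!` is computed by `decide` per tuple downstream).

References: [FordMaynard2024PrimeSieves] arXiv:2407.14368, §8 (proof of Theorem 2.7 (c)); orbit counting is folklore.
-/

noncomputable section

open Finset
open scoped Classical

namespace Summit.Parity.GeneralizedHardyLittlewood.FordMaynardNoSieveConst0164NegWitness0164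

/-- On a monotone (sorted) index tuple the symmetric table is the raw table: `lpCoeff0164 u = lpTable0164 u`.
[folklore] -/
theorem lpCoeff0164_of_monotone (u : Fin 5 → Fin 24) (hu : Monotone u) : lpCoeff0164 u = lpTable0164 u := by
  unfold lpCoeff0164
  rw [Tuple.sort_eq_refl_iff_monotone.2 hu]
  rfl

/-- Orbits of distinct monotone tuples under `S₅` are disjoint. [folklore] -/
theorem orbit_disjoint_of_monotone {u u' : Fin 5 → Fin 24} (hu : Monotone u) (hu' : Monotone u') (hne : u ≠ u') :
    Disjoint (Finset.univ.image (fun σ : Equiv.Perm (Fin 5) => (u ∘ ⇑σ : Fin 5 → Fin 24)))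
      (Finset.univ.image (fun σ : Equiv.Perm (Fin 5) => (u' ∘ ⇑σ : Fin 5 → Fin 24))) := by
  rw [Finset.disjoint_left]
  intro t ht ht'
  obtain ⟨σ, -, rfl⟩ := Finset.mem_image.1 ht
  obtain ⟨τ, -, hτ⟩ := Finset.mem_image.1 ht'
  -- `u' ∘ τ = u ∘ σ`, so `u = u' ∘ (τ * σ⁻¹)` is a monotone rearrangement of `u'`, hence `= u'`
  apply hne
  have h1 : u = u' ∘ ⇑(τ * σ⁻¹) := by
    rw [Equiv.Perm.coe_mul, ← Function.comp_assoc, hτ, Function.comp_assoc, ← Equiv.Perm.coe_mul,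
      mul_inv_cancel, Equiv.Perm.coe_one, Function.comp_id]
  have h2 : u' ∘ ⇑(τ * σ⁻¹) = u' ∘ ⇑(1 : Equiv.Perm (Fin 5)) :=
    Tuple.unique_monotone (h1 ▸ hu) (by simpa using hu')
  rw [h1, h2, Equiv.Perm.coe_one, Function.comp_id]

/-- **Orbit reorganisation (lower bound).** For a nonnegative permutation-invariant weight `X` and any finite set `U`
of monotone index tuples: `Σ_{u∈U} #orbit(u)·lpTable0164(u)·X(u) ≤ Σ_t lpCoeff0164(t)·X(t)`.
[cite: FordMaynard2024PrimeSieves, §8 (proof of Theorem 2.7 (c)); folklore] -/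
theorem sum_orbit_le_sum_lpCoeff (X : (Fin 5 → Fin 24) → ℝ) (hX0 : ∀ t, 0 ≤ X t)
    (hXsymm : ∀ (σ : Equiv.Perm (Fin 5)) (t : Fin 5 → Fin 24), X (t ∘ ⇑σ) = X t)
    (U : Finset (Fin 5 → Fin 24)) (hU : ∀ u ∈ U, Monotone u) :
    ∑ u ∈ U, ((Finset.univ.image (fun σ : Equiv.Perm (Fin 5) => (u ∘ ⇑σ : Fin 5 → Fin 24))).card : ℝ) *
        (lpTable0164 u * X u) ≤
      ∑ t, lpCoeff0164 t * X t := by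
  set orb : (Fin 5 → Fin 24) → Finset (Fin 5 → Fin 24) :=
    fun u => Finset.univ.image (fun σ : Equiv.Perm (Fin 5) => (u ∘ ⇑σ : Fin 5 → Fin 24)) with horb
  have hdisj : (U : Set (Fin 5 → Fin 24)).PairwiseDisjoint orb := by
    intro u hu u' hu' hne
    exact orbit_disjoint_of_monotone (hU u hu) (hU u' hu') hne
  -- the sum over the union of the orbits
  have h1 : ∑ t ∈ U.biUnion orb, lpCoeff0164 t * X t ≤ ∑ t, lpCoeff0164 t * X t :=
    Finset.sum_le_sum_of_subset_of_nonneg (Finset.subset_univ _)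
      (fun t _ _ => mul_nonneg (lpCoeff0164_nonneg t) (hX0 t))
  rw [Finset.sum_biUnion hdisj] at h1
  refine le_trans (le_of_eq (Finset.sum_congr rfl fun u hu => ?_)) h1
  -- on the orbit of `u` the summand is constant
  have hconst : ∀ t ∈ orb u, lpCoeff0164 t * X t = lpTable0164 u * X u := by
    intro t ht
    obtain ⟨σ, -, rfl⟩ := Finset.mem_image.1 ht
    rw [lpCoeff0164_comp_perm, hXsymm, lpCoeff0164_of_monotone u (hU u hu)]
  rw [Finset.sum_congr rfl hconst, Finset.sum_const, nsmul_eq_mul]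

end Summit.Parity.GeneralizedHardyLittlewood.FordMaynardNoSieveConst0164NegWitness0164

end
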